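import Summits.Schanuel.Schanuel.Theorems.RootDecomp1GradedConePad

/-!
# RootDecomp1GradedConeTransfer — part 3/5 of the port of lens-1 gen 13 «GRADED CONE» (route RootDecomp1 rev 22; THEOREM ROUND, critic VERDICT 2026-08-30T16:07:00Z ACCEPTED, (iii)-partial grade transfer = STRUCTURE currency; port optional-LOW (b))

§5: THE TRANSFERS Bₙ ∧ Bₙ₊ⱼ ∧ U⊥ₙ₊ⱼ ⟹ U♮ₙ (j ≥ 2) and Bₙ ∧ U♮ₘ ⟹ U♮ₙ (m ≥ n) — U⊥ is tail-determined mod B (kill criterion: counterexamples propagate upward by padding).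

Port (census-1 gen 8) of HOME/decomp-schanuel-lens-1/g13/GradedCone.lean (sha256 abae003f…, 1137 l, 74 theorems; rc 0 against rev 22). Hygiene per the critic:
h1 the graded `def … : Prop` are GRADINGS of the rows S / B / U⊥ / U♮ / Cⁿᵘ (cell definitions of this file, not route items and not cited facts);
h2 explicit `FaithfulSMul` instance kept; h3 the §8 `example` block stays; h4 `ladderCollapseGlue_of_graded` is a plain theorem (26483 closed by p778320);
h5 advisory lint.theses-cone expected (imports Theses.RootDecomp1). Namespace `Summit.Schanuel.Schanuel.Theorems.RootDecomp1GradedCone`; statements and proofs verbatim.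
`--supports stmt-Schanuel-29644`. Sorry-free; standard axioms. Nothing here proves Schanuel; rung 0.
-/

noncomputable section

set_option linter.dupNamespace false

namespace Summit.Schanuel.Schanuel.Theorems.RootDecomp1GradedCone

open Complex IntermediateField
open scoped BigOperators
open Summit.Schanuel.Schanuel.Theses.RootDecomp1 (SchanuelTwo EssentialCounterexamplesInEcl
  DefectOneSchanuel LinearSchanuel QuadraticSchanuel RationalImageSchanuel LadderCollapseGlue
  NonrationalSaturatedEssentialSchanuel closes)
open Summit.Schanuel.Schanuel.Theorems.RootDecomp1EssentialInEcl (essentialCounterexamplesInEcl_holds)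
open Literature.NumberTheory.Transcendental (transcendental_exp_holds)
open Literature.NumberTheory.Transcendental.OneMotiveToric (trdeg_mono)
open Literature.NumberTheory.Transcendental.Philippon1986_criterion (trdeg_adjoin_range_le)
open Literature.Barriers.Schanuel (algebraicIndependent_of_le_trdeg_adjoin
  trdeg_adjoin_union_eq_of_isAlgebraic)
open Summit.Schanuel.Schanuel.Theorems.RootDecomp1LadderCollapse (Qbar quad aeval_mem_adjoin exists_nat_trdeg_range
  algCoeff_map eval_map_Qbar aeval_quad totalDegree_quad_le gadget_rigid)
open Literature.RingTheory.MvPolynomial.Ruppert (totalDegree_pow_of_ne_zero)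


/-! ## 5. THE TRANSFERS `Bₙ ∧ Bₙ₊ⱼ ∧ U⊥ₙ₊ⱼ ⟹ U♮ₙ` (j ≥ 2) and `Bₙ ∧ U♮ₘ ⟹ U♮ₙ` (m ≥ n) -/

/-- No rational image without parameters: if `k = 0`, the numbers `z_i ≠ 0` and `e^{z_i}` would both
be algebraic — Hermite–Lindemann (tree theorem `transcendental_exp_holds`). -/
theorem params_pos {n k : ℕ} (z : Fin n → ℂ) (t : Fin k → ℂ) (hz : LinearIndependent ℚ z)
    (i : Fin n) (D : MvPolynomial (Fin k) Qbar) (N E : Fin n → MvPolynomial (Fin k) Qbar)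
    (hD0 : MvPolynomial.aeval t D ≠ 0)
    (hzN : ∀ i, z i * MvPolynomial.aeval t D = MvPolynomial.aeval t (N i))
    (hzE : ∀ i, cexp (z i) * MvPolynomial.aeval t D = MvPolynomial.aeval t (E i)) : 0 < k := by
  rcases Nat.eq_zero_or_pos k with hk | hk
  · exfalso
    subst hk
    have hz0 : z i ≠ 0 := hz.ne_zero i
    have hDa : IsAlgebraic ℚ (MvPolynomial.aeval t D) := by
      rw [MvPolynomial.eq_C_of_isEmpty D, MvPolynomial.aeval_C, Subalgebra.algebraMap_def]
      exact (MvPolynomial.coeff 0 D).2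
    have hNa : IsAlgebraic ℚ (MvPolynomial.aeval t (N i)) := by
      rw [MvPolynomial.eq_C_of_isEmpty (N i), MvPolynomial.aeval_C, Subalgebra.algebraMap_def]
      exact (MvPolynomial.coeff 0 (N i)).2
    have hEa : IsAlgebraic ℚ (MvPolynomial.aeval t (E i)) := by
      rw [MvPolynomial.eq_C_of_isEmpty (E i), MvPolynomial.aeval_C, Subalgebra.algebraMap_def]
      exact (MvPolynomial.coeff 0 (E i)).2
    have hza : IsAlgebraic ℚ (z i) := by
      rw [(eq_div_iff hD0).mpr (hzN i), div_eq_mul_inv]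
      exact hNa.mul hDa.inv
    have hea : IsAlgebraic ℚ (cexp (z i)) := by
      rw [(eq_div_iff hD0).mpr (hzE i), div_eq_mul_inv]
      exact hEa.mul hDa.inv
    exact transcendental_exp_holds hza hz0 hea
  · exact hk

/-- **The padded image.**  From a rational image `z ⊂ ℚ̄(t)` (`deg N_i ≤ d`, `t` algebraically
independent over ℚ̄) and the `j` pads `t_{j₀}^{d+1}, …, t_{j₀}^{d+j}`: the padded tuple `x = (z, pads)` is
ℚ-l.i. and `(x, e^x)` is a ℚ̄-rational image (same denominator) of the `k + j` numbers
`s = (t, e^{pads})`. -/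
theorem padded_image {n k d : ℕ} (j : ℕ) (z : Fin n → ℂ) (t : Fin k → ℂ)
    (hz : LinearIndependent ℚ z) (htS : AlgebraicIndependent Qbar t)
    (D : MvPolynomial (Fin k) Qbar) (N E : Fin n → MvPolynomial (Fin k) Qbar)
    (hN : ∀ i, (N i).totalDegree ≤ d) (hD0 : MvPolynomial.aeval t D ≠ 0)
    (hzN : ∀ i, z i * MvPolynomial.aeval t D = MvPolynomial.aeval t (N i))
    (hzE : ∀ i, cexp (z i) * MvPolynomial.aeval t D = MvPolynomial.aeval t (E i)) (j₀ : Fin k) :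
    ∃ (x : Fin (n + j) → ℂ) (s : Fin (k + j) → ℂ) (D' : MvPolynomial (Fin (k + j)) Qbar)
      (N' E' : Fin (n + j) → MvPolynomial (Fin (k + j)) Qbar),
      LinearIndependent ℚ x ∧ MvPolynomial.aeval s D' ≠ 0 ∧
      (∀ i, x i * MvPolynomial.aeval s D' = MvPolynomial.aeval s (N' i)) ∧
      (∀ i, cexp (x i) * MvPolynomial.aeval s D' = MvPolynomial.aeval s (E' i)) ∧
      (∀ l : Fin j, x (Fin.natAdd n l) = t j₀ ^ (d + 1 + (l : ℕ))) := by
  classical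
  set x : Fin (n + j) → ℂ := Fin.append z (fun l : Fin j => t j₀ ^ (d + 1 + (l : ℕ))) with hx
  set s : Fin (k + j) → ℂ :=
    Fin.append t (fun l : Fin j => cexp (t j₀ ^ (d + 1 + (l : ℕ)))) with hs
  have hxli : LinearIndependent ℚ x := linearIndependent_pad z t hz htS D N hN hD0 hzN j₀
  set D' : MvPolynomial (Fin (k + j)) Qbar := MvPolynomial.rename (Fin.castAdd j) D with hD'
  set N' : Fin (n + j) → MvPolynomial (Fin (k + j)) Qbar :=
    Fin.append (fun i => MvPolynomial.rename (Fin.castAdd j) (N i))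
      (fun l : Fin j => MvPolynomial.X (Fin.castAdd j j₀) ^ (d + 1 + (l : ℕ)) * D') with hN'
  set E' : Fin (n + j) → MvPolynomial (Fin (k + j)) Qbar :=
    Fin.append (fun i => MvPolynomial.rename (Fin.castAdd j) (E i))
      (fun l : Fin j => MvPolynomial.X (Fin.natAdd k l) * D') with hE'
  have hst : s ∘ Fin.castAdd j = t := funext fun i => by simp [hs]
  have hsj : s (Fin.castAdd j j₀) = t j₀ := by simp [hs]
  have hsl : ∀ l : Fin j, s (Fin.natAdd k l) = cexp (t j₀ ^ (d + 1 + (l : ℕ))) := fun l => by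
    simp [hs]
  have hD's : MvPolynomial.aeval s D' = MvPolynomial.aeval t D := by
    rw [hD', MvPolynomial.aeval_rename, hst]
  have hD'0 : MvPolynomial.aeval s D' ≠ 0 := by rw [hD's]; exact hD0
  have hxN' : ∀ i, x i * MvPolynomial.aeval s D' = MvPolynomial.aeval s (N' i) := by
    intro i
    refine Fin.addCases (fun i => ?_) (fun l => ?_) i
    · simp only [hx, hN', Fin.append_left, MvPolynomial.aeval_rename, hst, hD's]
      exact hzN i
    · simp only [hx, hN', Fin.append_right, map_mul, map_pow, MvPolynomial.aeval_X, hsj]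
  have hxE' : ∀ i, cexp (x i) * MvPolynomial.aeval s D' = MvPolynomial.aeval s (E' i) := by
    intro i
    refine Fin.addCases (fun i => ?_) (fun l => ?_) i
    · simp only [hx, hE', Fin.append_left, MvPolynomial.aeval_rename, hst, hD's]
      exact hzE i
    · simp only [hx, hE', Fin.append_right, map_mul, MvPolynomial.aeval_X, hsl]
  exact ⟨x, s, D', N', E', hxli, hD'0, hxN', hxE', fun l => by rw [hx, Fin.append_right]⟩

/-- **PADDING THEOREM, route form.**  Assume `Bₙ`, `B_{n+j}`, `U⊥_{n+j}` with `j ≥ 2`.  If `z` is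
ℚ-l.i. of length `n`, `z_i·D(t) = N_i(t)` with `deg N_i ≤ d` (`d ≥ 1`), `e^{z_i}·D(t) = E_i(t)`,
`D(t) ≠ 0`, for ℚ̄-polynomials in `t : Fin k → ℂ`, then `n ≤ k`.  (`B_{n+j}` is consumed by the clauses of
U⊥ at the padded tuple: tightness, and the numerics inside `pad_quadratic_clause`.) -/
theorem collapse {n k j d : ℕ} (hj : 2 ≤ j) (hBn : DefectOneAt n) (hBm : DefectOneAt (n + j))
    (hU : RationalImageAt (n + j)) (hd : 1 ≤ d)
    (z : Fin n → ℂ) (t : Fin k → ℂ) (hz : LinearIndependent ℚ z)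
    (D : MvPolynomial (Fin k) Qbar) (N E : Fin n → MvPolynomial (Fin k) Qbar)
    (hN : ∀ i, (N i).totalDegree ≤ d) (hD0 : MvPolynomial.aeval t D ≠ 0)
    (hzN : ∀ i, z i * MvPolynomial.aeval t D = MvPolynomial.aeval t (N i))
    (hzE : ∀ i, cexp (z i) * MvPolynomial.aeval t D = MvPolynomial.aeval t (E i)) : n ≤ k := by
  classical
  by_contra hkn
  push Not at hkn
  obtain ⟨-, hta⟩ := numerics hBn z t hz D N E hD0 hzN hzE hkn
  have hk : 0 < k := params_pos z t hz ⟨0, by omega⟩ D N E hD0 hzN hzE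
  set j₀ : Fin k := ⟨0, hk⟩ with hj₀
  have hu : Transcendental ℚ (t j₀) := hta.transcendental j₀
  obtain ⟨x, s, D', N', E', hxli, hD'0, hxN', hxE', hxpad⟩ :=
    padded_image j z t hz hta.subalgebraAlgebraicClosure D N E hN hD0 hzN hzE j₀
  have hx₁ : x (Fin.natAdd n ⟨0, by omega⟩) = t j₀ ^ (d + 1) := by rw [hxpad]; simp
  have hx₂ : x (Fin.natAdd n ⟨1, by omega⟩) = t j₀ ^ (d + 2) := by rw [hxpad]; simp [add_assoc]
  have hquad : QuadraticClause x := pad_quadratic_clause hBm hd x hxli (t j₀) hu _ _ hx₁ hx₂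
  have haff : AffineClause x := affineClause_of_quadraticClause x hquad
  have htight : Tight x := hBm x hxli
  have hle : n + j ≤ k + j :=
    hU x hxli haff hquad htight (k + j) s (MvPolynomial.map (algebraMap Qbar ℂ) D')
      (fun i => MvPolynomial.map (algebraMap Qbar ℂ) (N' i))
      (fun i => MvPolynomial.map (algebraMap Qbar ℂ) (E' i))
      (fun m => algCoeff_map D' m) (fun i m => algCoeff_map (N' i) m)
      (fun i m => algCoeff_map (E' i) m) (by rw [eval_map_Qbar]; exact hD'0)
      (fun i => by rw [eval_map_Qbar, eval_map_Qbar]; exact hxN' i)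
      (fun i => by rw [eval_map_Qbar, eval_map_Qbar]; exact hxE' i)
  omega

/-- **PADDING THEOREM, clause-free form.**  `Bₙ ∧ U♮ₙ₊ⱼ` already forces `n ≤ k` — for ANY `j ≥ 0`,
with no gadget and no hypothesis at level `n + j` other than `U♮ₙ₊ⱼ` itself. -/
theorem collapse_natural {n k j d : ℕ} (hBn : DefectOneAt n) (hU : RationalAt (n + j))
    (z : Fin n → ℂ) (t : Fin k → ℂ) (hz : LinearIndependent ℚ z)
    (D : MvPolynomial (Fin k) Qbar) (N E : Fin n → MvPolynomial (Fin k) Qbar)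
    (hN : ∀ i, (N i).totalDegree ≤ d) (hD0 : MvPolynomial.aeval t D ≠ 0)
    (hzN : ∀ i, z i * MvPolynomial.aeval t D = MvPolynomial.aeval t (N i))
    (hzE : ∀ i, cexp (z i) * MvPolynomial.aeval t D = MvPolynomial.aeval t (E i)) : n ≤ k := by
  classical
  by_contra hkn
  push Not at hkn
  obtain ⟨-, hta⟩ := numerics hBn z t hz D N E hD0 hzN hzE hkn
  have hk : 0 < k := params_pos z t hz ⟨0, by omega⟩ D N E hD0 hzN hzE
  obtain ⟨x, s, D', N', E', hxli, hD'0, hxN', hxE', -⟩ :=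
    padded_image j z t hz hta.subalgebraAlgebraicClosure D N E hN hD0 hzN hzE ⟨0, hk⟩
  have hle : n + j ≤ k + j :=
    hU x hxli (k + j) s (MvPolynomial.map (algebraMap Qbar ℂ) D')
      (fun i => MvPolynomial.map (algebraMap Qbar ℂ) (N' i))
      (fun i => MvPolynomial.map (algebraMap Qbar ℂ) (E' i))
      (fun m => algCoeff_map D' m) (fun i m => algCoeff_map (N' i) m)
      (fun i m => algCoeff_map (E' i) m) (by rw [eval_map_Qbar]; exact hD'0)
      (fun i => by rw [eval_map_Qbar, eval_map_Qbar]; exact hxN' i)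
      (fun i => by rw [eval_map_Qbar, eval_map_Qbar]; exact hxE' i)
  omega


/-- **TAIL DETERMINACY (clause-free form).**  For `m ≥ n + 2`: `Bₙ ∧ Bₘ ∧ U⊥ₘ ⟹ U♮ₙ`. -/
theorem rationalAt_of_higher {n m : ℕ} (hnm : n + 2 ≤ m) (hBn : DefectOneAt n) (hBm : DefectOneAt m)
    (hU : RationalImageAt m) : RationalAt n := by
  obtain ⟨j, rfl⟩ : ∃ j, m = n + j := ⟨m - n, by omega⟩
  intro z hz k t D N E hDa hNa hEa hD0 hzN hzE
  obtain ⟨D', rfl⟩ := exists_map_eq_of_algebraic D hDa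
  choose N' hN' using fun i => exists_map_eq_of_algebraic (N i) (hNa i)
  choose E' hE' using fun i => exists_map_eq_of_algebraic (E i) (hEa i)
  obtain ⟨d, hdN, hd1⟩ : ∃ d : ℕ, (∀ i, (N' i).totalDegree ≤ d) ∧ 1 ≤ d :=
    ⟨(Finset.univ.sup fun i => (N' i).totalDegree) ⊔ 1,
      fun i => le_sup_of_le_left (Finset.le_sup (f := fun i => (N' i).totalDegree) (Finset.mem_univ i)),
      le_sup_right⟩
  refine collapse (j := j) (by omega) hBn hBm hU hd1 z t hz D' N' E' hdN ?_ ?_ ?_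
  · rw [← eval_map_Qbar]; exact hD0
  · intro i; rw [← eval_map_Qbar, ← eval_map_Qbar, hN' i]; exact hzN i
  · intro i; rw [← eval_map_Qbar, ← eval_map_Qbar, hE' i]; exact hzE i

/-- **TAIL DETERMINACY of the row U⊥:** `Bₙ ∧ Bₘ ∧ U⊥ₘ ⟹ U⊥ₙ` for every `m ≥ n + 2`. -/
theorem rationalImageAt_of_higher {n m : ℕ} (hnm : n + 2 ≤ m) (hBn : DefectOneAt n)
    (hBm : DefectOneAt m) (hU : RationalImageAt m) : RationalImageAt n :=
  rationalImageAt_of_rationalAt (rationalAt_of_higher hnm hBn hBm hU)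

/-- `Bₙ ∧ Bₘ ∧ U⊥ₘ ⟹ Lₙ` for `m ≥ n + 2`. -/
theorem linearAt_of_higher {n m : ℕ} (hnm : n + 2 ≤ m) (hBn : DefectOneAt n) (hBm : DefectOneAt m)
    (hU : RationalImageAt m) : LinearAt n := by
  obtain ⟨j, rfl⟩ : ∃ j, m = n + j := ⟨m - n, by omega⟩
  intro z hz k t β₀ γ₀ β γ hβ₀ hβ hγ₀ hγ hzr her
  refine collapse (j := j) (by omega) hBn hBm hU (d := 2) (by norm_num) z t hz 1
    (fun i => quad ⟨β₀ i, hβ₀ i⟩ (fun a => ⟨β i a, hβ i a⟩) (fun _ _ => 0))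
    (fun i => quad ⟨γ₀ i, hγ₀ i⟩ (fun a => ⟨γ i a, hγ i a⟩) (fun _ _ => 0))
    (fun i => totalDegree_quad_le _ _ _) (by rw [map_one]; exact one_ne_zero) (fun i => ?_)
    (fun i => ?_)
  · rw [map_one, mul_one, aeval_quad]; simpa using hzr i
  · rw [map_one, mul_one, aeval_quad]; simpa using her i

/-- `Bₙ ∧ Bₘ ∧ U⊥ₘ ⟹ Qₙ` for `m ≥ n + 2`. -/
theorem quadraticAt_of_higher {n m : ℕ} (hnm : n + 2 ≤ m) (hBn : DefectOneAt n) (hBm : DefectOneAt m)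
    (hU : RationalImageAt m) : QuadraticAt n := by
  obtain ⟨j, rfl⟩ : ∃ j, m = n + j := ⟨m - n, by omega⟩
  intro z hz _ k t β₀ γ₀ β γ δ ε hβ₀ hβ hδ hγ₀ hγ hε hzr her
  refine collapse (j := j) (by omega) hBn hBm hU (d := 2) (by norm_num) z t hz 1
    (fun i => quad ⟨β₀ i, hβ₀ i⟩ (fun a => ⟨β i a, hβ i a⟩) (fun a a' => ⟨δ i a a', hδ i a a'⟩))
    (fun i => quad ⟨γ₀ i, hγ₀ i⟩ (fun a => ⟨γ i a, hγ i a⟩) (fun a a' => ⟨ε i a a', hε i a a'⟩))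
    (fun i => totalDegree_quad_le _ _ _) (by rw [map_one]; exact one_ne_zero) (fun i => ?_)
    (fun i => ?_)
  · rw [map_one, mul_one, aeval_quad]; exact hzr i
  · rw [map_one, mul_one, aeval_quad]; exact her i

/-- **Every grade of U⊥ at length `n` is implied by B and ANY grade `m ≥ n + 2`; so is U♮ₙ, Lₙ, Qₙ.** -/
theorem rows_of_higher {n m : ℕ} (hnm : n + 2 ≤ m) (hBn : DefectOneAt n) (hBm : DefectOneAt m)
    (hU : RationalImageAt m) : RationalAt n ∧ RationalImageAt n ∧ LinearAt n ∧ QuadraticAt n :=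
  ⟨rationalAt_of_higher hnm hBn hBm hU, rationalImageAt_of_higher hnm hBn hBm hU,
    linearAt_of_higher hnm hBn hBm hU, quadraticAt_of_higher hnm hBn hBm hU⟩

/-- **The critic's first target cell is not load-bearing:** `U⊥₂ ⟸ B₂ ∧ B₄ ∧ U⊥₄`
(B₂ is a theorem, `defectOneAt_of_le_three`). -/
theorem rationalImageAt_two_of_four (hB₂ : DefectOneAt 2) (hB₄ : DefectOneAt 4)
    (hU₄ : RationalImageAt 4) : RationalImageAt 2 :=
  rationalImageAt_of_higher (by norm_num) hB₂ hB₄ hU₄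

/-- **U⊥ from B and any COFINAL family of its grades** (no single grade is load-bearing). -/
theorem rationalImageSchanuel_of_cofinal (hB : DefectOneSchanuel)
    (hU : ∀ N : ℕ, ∃ m, N ≤ m ∧ RationalImageAt m) : RationalImageSchanuel :=
  rationalImageSchanuel_iff.mpr fun n => by
    obtain ⟨m, hm, hUm⟩ := hU (n + 2)
    exact rationalImageAt_of_higher hm (hB n) (hB m) hUm

/-- In particular: U⊥ is equivalent, modulo B, to each of its tails `⋀_{m ≥ N} U⊥ₘ`. -/
theorem rationalImageSchanuel_of_tail (hB : DefectOneSchanuel) (N : ℕ)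
    (hU : ∀ m, N ≤ m → RationalImageAt m) : RationalImageSchanuel :=
  rationalImageSchanuel_of_cofinal hB fun M => ⟨max N M, le_max_right _ _, hU _ (le_max_left _ _)⟩

/-- L from B and a cofinal family of U⊥-grades. -/
theorem linearSchanuel_of_cofinal (hB : DefectOneSchanuel)
    (hU : ∀ N : ℕ, ∃ m, N ≤ m ∧ RationalImageAt m) : LinearSchanuel :=
  linearSchanuel_iff.mpr fun n => by
    obtain ⟨m, hm, hUm⟩ := hU (n + 2)
    exact linearAt_of_higher hm (hB n) (hB m) hUm

/-- Q from B and a cofinal family of U⊥-grades. -/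
theorem quadraticSchanuel_of_cofinal (hB : DefectOneSchanuel)
    (hU : ∀ N : ℕ, ∃ m, N ≤ m ∧ RationalImageAt m) : QuadraticSchanuel :=
  quadraticSchanuel_iff.mpr fun n => by
    obtain ⟨m, hm, hUm⟩ := hU (n + 2)
    exact quadraticAt_of_higher hm (hB n) (hB m) hUm

/-- U♮ (all lengths) from B and a cofinal family of U⊥-grades. -/
theorem rationalAt_all_of_cofinal (hB : DefectOneSchanuel)
    (hU : ∀ N : ℕ, ∃ m, N ≤ m ∧ RationalImageAt m) (n : ℕ) : RationalAt n := by
  obtain ⟨m, hm, hUm⟩ := hU (n + 2)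
  exact rationalAt_of_higher hm (hB n) (hB m) hUm

/-- **DOWNWARD MONOTONICITY of the clause-free row:** `Bₙ ∧ U♮ₘ ⟹ U♮ₙ` for every `m ≥ n`
(in B only the grade `n` is used: no look-ahead at all). -/
theorem rationalAt_of_le {n m : ℕ} (hnm : n ≤ m) (hBn : DefectOneAt n) (hU : RationalAt m) :
    RationalAt n := by
  obtain ⟨j, rfl⟩ : ∃ j, m = n + j := ⟨m - n, by omega⟩
  intro z hz k t D N E hDa hNa hEa hD0 hzN hzE
  obtain ⟨D', rfl⟩ := exists_map_eq_of_algebraic D hDa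
  choose N' hN' using fun i => exists_map_eq_of_algebraic (N i) (hNa i)
  choose E' hE' using fun i => exists_map_eq_of_algebraic (E i) (hEa i)
  refine collapse_natural (j := j) (d := Finset.univ.sup fun i => (N' i).totalDegree) hBn hU z t hz
    D' N' E' (fun i => Finset.le_sup (f := fun i => (N' i).totalDegree) (Finset.mem_univ i)) ?_ ?_ ?_
  · rw [← eval_map_Qbar]; exact hD0
  · intro i; rw [← eval_map_Qbar, ← eval_map_Qbar, hN' i]; exact hzN i
  · intro i; rw [← eval_map_Qbar, ← eval_map_Qbar, hE' i]; exact hzE i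

/-- U♮ from B and any cofinal family of ITS OWN grades. -/
theorem rationalAt_all_of_cofinal_natural (hB : DefectOneSchanuel)
    (hU : ∀ N : ℕ, ∃ m, N ≤ m ∧ RationalAt m) (n : ℕ) : RationalAt n := by
  obtain ⟨m, hm, hUm⟩ := hU n
  exact rationalAt_of_le hm (hB n) hUm

end Summit.Schanuel.Schanuel.Theorems.RootDecomp1GradedCone
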